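import Summits.NavierStokesRegularity.NavierStokesRegularity.Theorems.QuantisedSymmetryPolyhedralDssProfileExistsStubSmoothRepresentativeAe
import Summits.NavierStokesRegularity.NavierStokesRegularity.Theorems.QuantisedSymmetryPolyhedralDssProfileExistsStubClassicalOfOseenMildPast
import Literature.Analysis.FluidPDE.ChaeWolfRemovingDSSBounds
import HarnessLib

/-!
# Crux `PolyhedralDssProfileExists` (X⁻, stmt-NavierStokesRegularity-1404), line `polyhedral_cell` —
# stub `stub_noSmallConstant` (N2: the Type-I constant of a witness is not small)

Registered stub `stub_noSmallConstant` (`--supports stmt-NavierStokesRegularity-1404`): the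
NECESSARY CONDITION "the Type-I constant of a witness of the crux is not small", i.e. the
ε-regularity removal of Chae–Wolf 2017, Remark 1.4 / proof of Thm. 1.3 Step 1
(Gustafson–Kang–Tsai), restated on the crux's own variables.  There is an absolute `ε > 0` such that
every ancient mild solution `u` of 3-D Navier–Stokes in the tree's duality form
(`IsAncientMildSolution 1 u`, measurable slices) with the Type-I space–time bound
`‖u(t, x)‖ ≤ C₀ / (‖x‖ + √(−t))` and `C₀ ≤ ε` has all its negative slices a.e. zero.  Neither
self-similarity nor symmetry enter.

Proof.  Take `ε := ε₀` from `ChaeWolf.exists_eps_typeI_small_eq_zero` (Type-I classical solutions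
on the past with a small scale-invariant bound `√(−t)‖u‖ ≤ ε₀` vanish).  A negative `C₀` is vacuous:
the Type-I bound at `(t, x) = (−1, 0)` forces `0 ≤ C₀`.  Pass to the smooth Oseen-gauge
representative `V` of `u` (`stub_smoothRepresentative_ae`: `IsTypeIAncientMild C V`, the same
Type-I space–time bound `HasTypeIDecay C₀ V`, `V(t) = u(t)` a.e. for every `t < 0`), reconstruct a
classical pressure on the past (`exists_isClassicalNSSolutionOn_Iio_of_isTypeIAncientMild`), and
note the scale-invariant smallness `√(−t)‖V(t, x)‖ ≤ C₀ ≤ ε₀` (multiply the Type-I bound by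
`√(−t) ≤ ‖x‖ + √(−t)`).  Hence `V ≡ 0` on the past and `u(t) = V(t) = 0` a.e. for every `t < 0`.
-/

noncomputable section

-- the summit namespace `…NavierStokesRegularity.NavierStokesRegularity…` is the tree convention (D-0017)
set_option linter.dupNamespace false

namespace Summit.NavierStokesRegularity.NavierStokesRegularity.Theorems.PolyhedralDssProfileExists.PolyhedralCell

open MeasureTheory Set Function Filter Topology
open Literature.Analysis Literature.Analysis.FluidPDE

/-- **The scale-invariant smallness of a Type-I field.** From the Type-I space–time bound
`‖u(t, x)‖ ≤ C₀ / (‖x‖ + √(−t))` (`C₀ ≥ 0`): `√(−t) ‖u(t, x)‖ ≤ C₀` for all `t < 0` and all `x`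
(multiply by `√(−t) ≤ ‖x‖ + √(−t)`). [folklore] -/
theorem sqrt_mul_norm_le_of_hasTypeIDecay
    {u : ℝ → EuclideanSpace ℝ (Fin 3) → EuclideanSpace ℝ (Fin 3)} {C₀ : ℝ}
    (h : HasTypeIDecay C₀ u) : ∀ t < 0, ∀ x, √(-t) * ‖u t x‖ ≤ C₀ := by
  intro t ht x
  have hs : 0 < √(-t) := Real.sqrt_pos.2 (neg_pos.2 ht)
  have hle : √(-t) ≤ ‖x‖ + √(-t) := le_add_of_nonneg_left (norm_nonneg _)
  have hD : 0 < ‖x‖ + √(-t) := hs.trans_le hle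
  calc √(-t) * ‖u t x‖ ≤ (‖x‖ + √(-t)) * ‖u t x‖ :=
        mul_le_mul_of_nonneg_right hle (norm_nonneg _)
    _ ≤ (‖x‖ + √(-t)) * (C₀ / (‖x‖ + √(-t))) := mul_le_mul_of_nonneg_left (h t ht x) hD.le
    _ = C₀ := mul_div_cancel₀ _ hD.ne'

/-- **REGISTERED NECESSARY CONDITION `stub_noSmallConstant`: the Type-I constant of a witness is not
small** (the ε-regularity removal of Chae–Wolf 2017, Rem. 1.4 / proof of Thm. 1.3 Step 1,
Gustafson–Kang–Tsai, on the crux's own variables).  There is an absolute `ε > 0` such that every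
ancient mild solution `u` of 3-D Navier–Stokes in the duality form with measurable slices and the
Type-I space–time bound `HasTypeIDecay C₀ u` with `C₀ ≤ ε` has `u(t) = 0` a.e. for every `t < 0`.
Proof: `ε := ε₀` of `ChaeWolf.exists_eps_typeI_small_eq_zero`; `0 ≤ C₀` from the bound at
`(−1, 0)`; the smooth representative `V` (`stub_smoothRepresentative_ae`) is a classical solution on
the past (`exists_isClassicalNSSolutionOn_Iio_of_isTypeIAncientMild`) with
`√(−t)‖V(t, x)‖ ≤ C₀ ≤ ε₀` (`sqrt_mul_norm_le_of_hasTypeIDecay`), hence `V ≡ 0` on the past and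
`u(t) = V(t) = 0` a.e.  Consequently every witness of the crux has `C₀ > ε`.
[cite: ChaeWolf2017RemovingDSS, Remark 1.4 and §3 Step 1] -/
theorem stub_noSmallConstant :
    ∃ ε : ℝ, 0 < ε ∧ ∀ (u : ℝ → EuclideanSpace ℝ (Fin 3) → EuclideanSpace ℝ (Fin 3)) (C₀ : ℝ),
      IsAncientMildSolution 1 u → (∀ t < 0, AEStronglyMeasurable (u t) volume) →
      HasTypeIDecay C₀ u → C₀ ≤ ε → ∀ t < 0, u t =ᵐ[volume] 0 := by
  obtain ⟨ε₀, hε₀, hsmall⟩ := ChaeWolf.exists_eps_typeI_small_eq_zero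
  refine ⟨ε₀, hε₀, ?_⟩
  intro u C₀ hanc hmeas hdec hCε t ht
  -- a negative constant is vacuous
  have hC₀ : 0 ≤ C₀ := by simpa using (norm_nonneg _).trans (hdec (-1) (by norm_num) 0)
  -- the smooth Oseen-gauge representative and its classical pressure on the past
  obtain ⟨V, C, hK, hdecV, hVu, -⟩ := stub_smoothRepresentative_ae u C₀ hanc hmeas hdec
  obtain ⟨p, hcl⟩ := exists_isClassicalNSSolutionOn_Iio_of_isTypeIAncientMild hK
  -- the scale-invariant smallness `√(-t) ‖V‖ ≤ C₀ ≤ ε₀`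
  have hsm : ∀ s < 0, ∀ x, √(-s) * ‖V s x‖ ≤ ε₀ := fun s hs x =>
    (sqrt_mul_norm_le_of_hasTypeIDecay hdecV s hs x).trans hCε
  -- Chae–Wolf Step 1 kills `V`, hence the slice of `u`
  have hz := hsmall hC₀ hcl hdecV hsm
  have hV0 : V t = 0 := funext fun x => hz t ht x
  calc u t =ᵐ[volume] V t := (hVu t ht).symm
    _ = 0 := hV0

end Summit.NavierStokesRegularity.NavierStokesRegularity.Theorems.PolyhedralDssProfileExists.PolyhedralCell

end
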